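import Mathlib
import Literature.NumberTheory.LFunctions.Zhang2022.Section7ExtendedRangeDecl
import Literature.NumberTheory.LFunctions.Zhang2022.Section7cEq712
import Literature.NumberTheory.LFunctions.Zhang2022.Section7cStep31
import Literature.NumberTheory.LFunctions.Zhang2022.Section7cProofs
import Literature.NumberTheory.LFunctions.Zhang2022.Section2FrakP
import HarnessLib

/-!
# Zhang (2022) §7, G-adj2-1 (F3c): (7.11) holds — the §7 error leg closes on the full support

Topic `Literature/NumberTheory/LFunctions/Zhang2022` (Landau–Siegel audit tree; verdict-neutral).
Y. Zhang, *Discrete mean estimates and the Landau–Siegel zero*, arXiv:2211.02515v1 (2022)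
[Zhang2022LandauSiegel] — **an unrefereed manuscript under adjudication**. D-0069 campaign, cell
`siegel-zhang`, GAP-LEDGER row G-adj2-1.

* `eq711X_holds` / `eq711X'_holds` — **(7.11) holds outright** (`Iface.Eq711 c′` and the owner's
  `Section7bStatements.Eq711 c′`): the deduction (7.12) (landed `eq712_holds`) and the
  reduction-to-primitive §7.u031 (landed `step7u031_holds`) give, over the FULL (7.2) support and
  with the exact (7.13) weight identity `(1/d)·(1/(kφ(k)))·√r = (dhφ(hr)√r)⁻¹` (`k = hr`), the
  bound `‖Σ_{p∼P} p^{β₃}𝔗₁₂(p)‖ ≤ B·C·Σ term713` over ALL support triples `dhr < PT⁻²` — the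
  honest form of the printed (7.13), which restricts to `dhr < P₁` without justification
  (GAP-LEDGER G-adj2-1, kernel certificate p412643). The triple sum is `≤ 2P²D^{−c}`
  (`sum_tripleX_le`, F3b), and `𝔓 ≥ ½P²𝓛⁻⁷⁷` ((2.9), `frakP_bounds`) absorbs the loss.

With this theorem the §7 error leg of Proposition 7.1 is kernel-complete with NO open
printed-range statement: the landed `eq711_of_eq713_smallR` reduction (h711 ⇐ Eq713) is
superseded by an outright proof of its conclusion. The printed (7.13) AS PRINTED remains not
derivable (its range drops support triples — the row's finding is unchanged); what this file
shows is that the dropped range is harmless, exactly as the row's repair disposition predicted.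

Theorems only; 0 new definitions; 0 new facts.

WHAT THIS IS NOT: a derivation of the printed (7.13) (the as-printed range restriction stays
unjustified); any change to `Margin232` custody; any claim about Theorems 1–2 of the manuscript
or about Landau–Siegel zeros.

## References

* Y. Zhang, arXiv:2211.02515v1 (2022), §7 pp. 37–39, (7.2), (7.11)–(7.15), tex L1813–L2058;
  §2 (2.9). [cite: Zhang2022LandauSiegel, §7 pp. 37–39]
-/

noncomputable section

open Complex Real Finset

namespace Literature.NumberTheory.LFunctions.Zhang2022.Section7cStatements

open Literature.NumberTheory.LFunctions.Zhang2022.Skeleton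

open scoped Classical

/-! ## Elementary helpers (local copies of private lemmas of the lane, unchanged) -/

/-- `K·𝓛ᵏ·D^{−c} ≤ η` for `D` large (local copy of the lane's eventual-decay lemma). [folklore] -/
private theorem ell_pow_mul_rpow_neg_eventuallyE (k : ℕ) {c : ℝ} (hc : 0 < c) {η : ℝ}
    (hη : 0 < η) (K : ℝ) : ∃ D₀ : ℕ, ∀ D : ℕ, D₀ ≤ D →
      K * Skeleton.ell D ^ k * (D : ℝ) ^ (-c) ≤ η := by
  set K' : ℝ := max K 0 with hK'
  set A : ℝ := K' * (Nat.factorial k : ℝ) * (2 / c) ^ k with hA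
  have hA0 : 0 ≤ A := by positivity
  set x₀ : ℝ := max 0 (2 / c * Real.log ((A + 1) / η)) with hx₀
  refine ⟨⌈Real.exp x₀⌉₊, fun D hD => ?_⟩
  have hexpD : Real.exp x₀ ≤ D := le_trans (Nat.le_ceil _) (by exact_mod_cast hD)
  have hDpos : (0 : ℝ) < D := lt_of_lt_of_le (Real.exp_pos _) hexpD
  have hx : x₀ ≤ Skeleton.ell D := by
    rw [Skeleton.ell]; exact (Real.le_log_iff_exp_le hDpos).mpr hexpD
  have hℓ0 : 0 ≤ Skeleton.ell D := le_trans (le_max_left _ _) hx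
  have hrpow : (D : ℝ) ^ (-c) = Real.exp (-(c * Skeleton.ell D)) := by
    rw [Real.rpow_def_of_pos hDpos, Skeleton.ell]; ring_nf
  have hpow : Skeleton.ell D ^ k ≤
      (Nat.factorial k : ℝ) * (2 / c) ^ k * Real.exp (c * Skeleton.ell D / 2) := by
    have h := Real.pow_div_factorial_le_exp (c * Skeleton.ell D / 2) (by positivity) k
    have hk : (0 : ℝ) < Nat.factorial k := by exact_mod_cast Nat.factorial_pos k
    rw [div_le_iff₀ hk] at h
    have hc2 : (c * Skeleton.ell D / 2) ^ k = (c / 2) ^ k * Skeleton.ell D ^ k := by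
      rw [← mul_pow]; ring
    rw [hc2] at h
    have hcpos : 0 < (c / 2) ^ k := by positivity
    calc Skeleton.ell D ^ k = (c / 2) ^ k * Skeleton.ell D ^ k * ((c / 2) ^ k)⁻¹ := by
          field_simp
      _ ≤ Real.exp (c * Skeleton.ell D / 2) * Nat.factorial k * ((c / 2) ^ k)⁻¹ :=
          mul_le_mul_of_nonneg_right h (by positivity)
      _ = (Nat.factorial k : ℝ) * (2 / c) ^ k * Real.exp (c * Skeleton.ell D / 2) := by
          rw [show ((c / 2) ^ k)⁻¹ = (2 / c) ^ k by rw [← inv_pow, inv_div]]; ring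
  have htail : Real.exp (-(c * Skeleton.ell D / 2)) ≤ η / (A + 1) := by
    have h1 : 2 / c * Real.log ((A + 1) / η) ≤ Skeleton.ell D :=
      le_trans (le_max_right _ _) hx
    have h2 : Real.log ((A + 1) / η) ≤ c * Skeleton.ell D / 2 := by
      have := mul_le_mul_of_nonneg_left h1 (show 0 ≤ c / 2 by positivity)
      calc Real.log ((A + 1) / η) = c / 2 * (2 / c * Real.log ((A + 1) / η)) := by
            field_simp
        _ ≤ c / 2 * Skeleton.ell D := this
        _ = c * Skeleton.ell D / 2 := by ring
    calc Real.exp (-(c * Skeleton.ell D / 2)) ≤ Real.exp (-Real.log ((A + 1) / η)) :=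
          Real.exp_le_exp.mpr (neg_le_neg h2)
      _ = η / (A + 1) := by
          rw [Real.exp_neg, Real.exp_log (by positivity), inv_div]
  calc K * Skeleton.ell D ^ k * (D : ℝ) ^ (-c)
      ≤ K' * Skeleton.ell D ^ k * (D : ℝ) ^ (-c) :=
        mul_le_mul_of_nonneg_right (mul_le_mul_of_nonneg_right (le_max_left _ _)
          (pow_nonneg hℓ0 _)) (Real.rpow_nonneg hDpos.le _)
    _ ≤ K' * ((Nat.factorial k : ℝ) * (2 / c) ^ k * Real.exp (c * Skeleton.ell D / 2)) *
          (D : ℝ) ^ (-c) :=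
        mul_le_mul_of_nonneg_right (mul_le_mul_of_nonneg_left hpow (le_max_right _ _))
          (Real.rpow_nonneg hDpos.le _)
    _ = A * (Real.exp (c * Skeleton.ell D / 2) * Real.exp (-(c * Skeleton.ell D))) := by
        rw [hrpow, hA]; ring
    _ = A * Real.exp (-(c * Skeleton.ell D / 2)) := by rw [← Real.exp_add]; ring_nf
    _ ≤ A * (η / (A + 1)) := mul_le_mul_of_nonneg_left htail hA0
    _ ≤ η := by
        rw [mul_div_assoc']
        rw [div_le_iff₀ (by positivity)]
        nlinarith

/-- `2 ≤ 𝓛` for `D` large (threshold form). [folklore] -/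
private theorem term713_nonnegE (c' : ℝ) (D : ℕ) (a₁ : ℕ → ℂ) (x : ℕ × ℕ × ℕ) :
    0 ≤ term713 c' D a₁ x := by
  unfold term713
  refine mul_nonneg (inv_nonneg.mpr (by positivity)) (Finset.sum_nonneg fun θ _ => ?_)
  split_ifs
  · exact norm_nonneg _
  · exact le_rfl

/-! ## The honest (7.12) → (full-support triple sum) insertion -/

set_option maxHeartbeats 1000000 in
/-- **The honest insertion**: for all large `D` under (A), admissible `𝐚₁, 𝐚₂` and the landed
(7.12) identity and §7.u031 bound, `‖Σ_{p∼P} p^{β₃}𝔗₁₂(p)‖ ≤ max B 0 · max C₀ 0 ·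
Σ_{dhr < PT⁻²} term713` — the (7.13) step carried out over the FULL (7.2) support (no `dhr < P₁`
restriction; the weight identity `(1/d)·(1/(kφ(k)))·√r = (dhφ(hr)√r)⁻¹` for `k = hr`).
[cite: Zhang2022LandauSiegel, §7 (7.12)–(7.13) pp. 37–38, tex L1991–L2010] -/
private theorem insertX (c' : ℝ) (B : ℝ) :
    ∃ C : ℝ, 0 ≤ C ∧ Skeleton.ForAllLarge fun D _ χ => Skeleton.AssumptionA D χ →
      ∀ a₁ a₂ : ℕ → ℂ, Skeleton.Adm72 D B a₁ → Skeleton.Adm72 D B a₂ →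
        ‖∑ p ∈ Skeleton.primeWindow D, (p : ℂ) ^ Skeleton.beta3 c' D *
            Iface.frakT12 c' D p a₁ a₂‖ ≤
          C * ∑ x ∈ ((Finset.Ico 1 (Skeleton.Nsupp D)) ×ˢ ((Finset.Ico 1 (Skeleton.Nsupp D)) ×ˢ
                (Finset.Ico 2 (Skeleton.Nsupp D)))).filter
              (fun x => ((x.1 * x.2.1 * x.2.2 : ℕ) : ℝ) <
                Skeleton.bigP D / Skeleton.bigT D ^ 2),
            term713 c' D a₁ x := by
  classical
  obtain ⟨D₁, h712⟩ := eq712_holds c' B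
  obtain ⟨C₀, D₂, h31⟩ := step7u031_holds c' B
  set B₀ : ℝ := max B 0 with hB₀
  set C₀' : ℝ := max C₀ 0 with hC₀'
  have hB₀0 : 0 ≤ B₀ := le_max_right _ _
  have hC₀'0 : 0 ≤ C₀' := le_max_right _ _
  refine ⟨B₀ * C₀', by positivity, max D₁ D₂, fun D _ χ hD hq hp hA a₁ a₂ ha₁ ha₂ => ?_⟩
  have hD₁ : D₁ ≤ D := le_trans (le_max_left _ _) hD
  have hD₂ : D₂ ≤ D := le_trans (le_max_right _ _) hD
  set N₁ : ℕ := Skeleton.Nsupp D with hN₁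
  set XT := ((Finset.Ico 1 N₁) ×ˢ ((Finset.Ico 1 N₁) ×ˢ (Finset.Ico 2 N₁))).filter
    (fun x => ((x.1 * x.2.1 * x.2.2 : ℕ) : ℝ) < Skeleton.bigP D / Skeleton.bigT D ^ 2) with hXT
  have hXT0 : 0 ≤ ∑ x ∈ XT, term713 c' D a₁ x :=
    Finset.sum_nonneg fun x _ => term713_nonnegE c' D a₁ x
  -- the (7.12) identity and the triangle inequality
  have hid := h712 D χ hD₁ hq hp hA a₁ a₂ ha₁ ha₂
  -- the per-`(d,k)` bound
  have hdk : ∀ d ∈ Finset.Ico 1 N₁, ∀ k ∈ Finset.Ico 1 N₁,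
      ‖1 / (d : ℂ) * (a₂ (d * k) / ((k : ℂ) * (Nat.totient k : ℂ)) *
          innerSum712 c' D a₁ d k)‖ ≤
        B₀ * C₀' * (if ((d * k : ℕ) : ℝ) < Skeleton.bigP D / Skeleton.bigT D ^ 2 then
          ∑ y ∈ k.divisorsAntidiagonal.filter (fun y => 1 < y.2),
            term713 c' D a₁ (d, y.1, y.2) else 0) := by
    intro d hd k hk
    rw [Finset.mem_Ico] at hd hk
    have hd0 : 0 < d := hd.1
    have hk0 : 0 < k := hk.1
    have hd0' : (0 : ℝ) < d := by exact_mod_cast hd0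
    have hk0' : (0 : ℝ) < k := by exact_mod_cast hk0
    have hφk : (0 : ℝ) < (Nat.totient k : ℝ) := by
      exact_mod_cast Nat.totient_pos.mpr hk0
    by_cases hsupp : ((d * k : ℕ) : ℝ) < Skeleton.bigP D / Skeleton.bigT D ^ 2
    swap
    · -- outside the support: `a₂(dk) = 0`
      rw [if_neg hsupp, mul_zero]
      have hz : a₂ (d * k) = 0 := by
        refine ha₂.2 (d * k) ?_
        push Not at hsupp
        exact hsupp
      rw [hz]
      simp only [zero_div, zero_mul, mul_zero, norm_zero]
      exact le_refl 0
    rw [if_pos hsupp]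
    -- inside the support: §7.u031
    have h31' := h31 D χ hD₂ hq hp hA a₁ ha₁ d k hd0 hk0 hsupp
    -- norms
    have hnorm : ‖1 / (d : ℂ) * (a₂ (d * k) / ((k : ℂ) * (Nat.totient k : ℂ)) *
        innerSum712 c' D a₁ d k)‖ =
        (1 / (d : ℝ)) * (‖a₂ (d * k)‖ / ((k : ℝ) * (Nat.totient k : ℝ))) *
          ‖innerSum712 c' D a₁ d k‖ := by
      simp only [norm_mul, norm_div, norm_one, Complex.norm_natCast]
      ring
    rw [hnorm]
    have ha₂B : ‖a₂ (d * k)‖ ≤ B₀ := le_trans (ha₂.1 (d * k)) (le_max_left _ _)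
    -- `‖inner‖ ≤ C₀'·(the √r-weighted sum)`
    have hAsum0 : 0 ≤ ∑ x ∈ k.divisorsAntidiagonal,
        (if 1 < x.2 then Real.sqrt x.2 * ∑ θ : DirichletCharacter ℂ x.2,
          (if θ.IsPrimitive then ‖frakS c' D a₁ x.2 x.1 d θ‖ else 0) else 0) := by
      refine Finset.sum_nonneg fun x _ => ?_
      split_ifs
      · refine mul_nonneg (Real.sqrt_nonneg _) (Finset.sum_nonneg fun θ _ => ?_)
        split_ifs
        · exact norm_nonneg _
        · exact le_rfl
      · exact le_rfl
    have hinner : ‖innerSum712 c' D a₁ d k‖ ≤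
        C₀' * ∑ x ∈ k.divisorsAntidiagonal,
          (if 1 < x.2 then Real.sqrt x.2 * ∑ θ : DirichletCharacter ℂ x.2,
            (if θ.IsPrimitive then ‖frakS c' D a₁ x.2 x.1 d θ‖ else 0) else 0) :=
      le_trans h31' (mul_le_mul_of_nonneg_right (le_max_left _ _) hAsum0)
    -- assemble with the weight identity per antidiagonal pair
    have hstep : (1 / (d : ℝ)) * (B₀ / ((k : ℝ) * (Nat.totient k : ℝ))) *
        (C₀' * ∑ x ∈ k.divisorsAntidiagonal,
          (if 1 < x.2 then Real.sqrt x.2 * ∑ θ : DirichletCharacter ℂ x.2,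
            (if θ.IsPrimitive then ‖frakS c' D a₁ x.2 x.1 d θ‖ else 0) else 0)) =
        B₀ * C₀' * ∑ x ∈ k.divisorsAntidiagonal,
          (if 1 < x.2 then (1 / (d : ℝ)) * (1 / ((k : ℝ) * (Nat.totient k : ℝ))) *
            (Real.sqrt x.2 * ∑ θ : DirichletCharacter ℂ x.2,
              (if θ.IsPrimitive then ‖frakS c' D a₁ x.2 x.1 d θ‖ else 0)) else 0) := by
      rw [Finset.mul_sum, Finset.mul_sum, Finset.mul_sum]
      refine Finset.sum_congr rfl fun x _ => ?_
      split_ifs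
      · ring
      · ring
    have hweight : ∀ x ∈ k.divisorsAntidiagonal, 1 < x.2 →
        (1 / (d : ℝ)) * (1 / ((k : ℝ) * (Nat.totient k : ℝ))) *
          (Real.sqrt x.2 * ∑ θ : DirichletCharacter ℂ x.2,
            (if θ.IsPrimitive then ‖frakS c' D a₁ x.2 x.1 d θ‖ else 0)) =
        term713 c' D a₁ (d, x.1, x.2) := by
      intro x hx hx2
      obtain ⟨hxk, hk0''⟩ := Nat.mem_divisorsAntidiagonal.mp hx
      have hh0 : 0 < x.1 := by
        rcases Nat.eq_zero_or_pos x.1 with h0 | h0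
        · exfalso; rw [h0, zero_mul] at hxk; omega
        · exact h0
      have hr0 : 0 < x.2 := by omega
      have hr0' : (0 : ℝ) < x.2 := by exact_mod_cast hr0
      have hsq0 : (0 : ℝ) < Real.sqrt x.2 := Real.sqrt_pos.mpr hr0'
      have hφhr : (0 : ℝ) < (Nat.totient (x.1 * x.2) : ℝ) := by
        exact_mod_cast Nat.totient_pos.mpr (Nat.mul_pos hh0 hr0)
      have hkeq : (k : ℝ) = ((x.1 * x.2 : ℕ) : ℝ) := by exact_mod_cast hxk.symm
      have hφeq : (Nat.totient k : ℝ) = (Nat.totient (x.1 * x.2) : ℝ) := by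
        rw [← hxk]
      have hh0' : (0 : ℝ) < x.1 := by exact_mod_cast hh0
      unfold term713
      simp only
      rw [hkeq, hφeq]
      have hcast : ((x.1 * x.2 : ℕ) : ℝ) = (x.1 : ℝ) * x.2 := by push_cast; ring
      have hcast2 : ((d * x.1 : ℕ) : ℝ) = (d : ℝ) * x.1 := by push_cast; ring
      rw [hcast, hcast2]
      set sq : ℝ := Real.sqrt (x.2 : ℝ) with hsq
      have hss : sq * sq = ((x.2 : ℕ) : ℝ) := Real.mul_self_sqrt hr0'.le
      rw [show ((x.2 : ℕ) : ℝ) = sq * sq from hss.symm]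
      field_simp
      try ring
    calc (1 / (d : ℝ)) * (‖a₂ (d * k)‖ / ((k : ℝ) * (Nat.totient k : ℝ))) *
          ‖innerSum712 c' D a₁ d k‖
        ≤ (1 / (d : ℝ)) * (B₀ / ((k : ℝ) * (Nat.totient k : ℝ))) *
            (C₀' * ∑ x ∈ k.divisorsAntidiagonal,
              (if 1 < x.2 then Real.sqrt x.2 * ∑ θ : DirichletCharacter ℂ x.2,
                (if θ.IsPrimitive then ‖frakS c' D a₁ x.2 x.1 d θ‖ else 0) else 0)) := by
          have h1 : ‖a₂ (d * k)‖ / ((k : ℝ) * (Nat.totient k : ℝ)) ≤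
              B₀ / ((k : ℝ) * (Nat.totient k : ℝ)) :=
            div_le_div_of_nonneg_right ha₂B (by positivity) |>.trans_eq rfl
          have h2 : 0 ≤ (1 / (d : ℝ)) := by positivity
          have h3 : 0 ≤ ‖innerSum712 c' D a₁ d k‖ := norm_nonneg _
          calc (1 / (d : ℝ)) * (‖a₂ (d * k)‖ / ((k : ℝ) * (Nat.totient k : ℝ))) *
                ‖innerSum712 c' D a₁ d k‖
              ≤ (1 / (d : ℝ)) * (B₀ / ((k : ℝ) * (Nat.totient k : ℝ))) *
                ‖innerSum712 c' D a₁ d k‖ := by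
                refine mul_le_mul_of_nonneg_right ?_ h3
                exact mul_le_mul_of_nonneg_left h1 h2
            _ ≤ (1 / (d : ℝ)) * (B₀ / ((k : ℝ) * (Nat.totient k : ℝ))) *
                (C₀' * ∑ x ∈ k.divisorsAntidiagonal,
                  (if 1 < x.2 then Real.sqrt x.2 * ∑ θ : DirichletCharacter ℂ x.2,
                    (if θ.IsPrimitive then ‖frakS c' D a₁ x.2 x.1 d θ‖ else 0) else 0)) := by
                refine mul_le_mul_of_nonneg_left hinner ?_
                positivity
      _ = B₀ * C₀' * ∑ x ∈ k.divisorsAntidiagonal,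
            (if 1 < x.2 then (1 / (d : ℝ)) * (1 / ((k : ℝ) * (Nat.totient k : ℝ))) *
              (Real.sqrt x.2 * ∑ θ : DirichletCharacter ℂ x.2,
                (if θ.IsPrimitive then ‖frakS c' D a₁ x.2 x.1 d θ‖ else 0)) else 0) := hstep
      _ = B₀ * C₀' * ∑ x ∈ k.divisorsAntidiagonal.filter (fun y => 1 < y.2),
            (1 / (d : ℝ)) * (1 / ((k : ℝ) * (Nat.totient k : ℝ))) *
              (Real.sqrt x.2 * ∑ θ : DirichletCharacter ℂ x.2,
                (if θ.IsPrimitive then ‖frakS c' D a₁ x.2 x.1 d θ‖ else 0)) := by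
          rw [Finset.sum_filter]
      _ = B₀ * C₀' * ∑ x ∈ k.divisorsAntidiagonal.filter (fun y => 1 < y.2),
            term713 c' D a₁ (d, x.1, x.2) := by
          congr 1
          refine Finset.sum_congr rfl fun x hx => ?_
          exact hweight x (Finset.mem_filter.mp hx).1 (Finset.mem_filter.mp hx).2
  -- sum over `(d,k)` and reindex the `(k,(h,r))`-pairs into triples
  have htri : ∀ d ∈ Finset.Ico 1 N₁,
      (∑ k ∈ Finset.Ico 1 N₁,
        (if ((d * k : ℕ) : ℝ) < Skeleton.bigP D / Skeleton.bigT D ^ 2 then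
          ∑ y ∈ k.divisorsAntidiagonal.filter (fun y => 1 < y.2),
            term713 c' D a₁ (d, y.1, y.2) else 0)) ≤
      ∑ y ∈ ((Finset.Ico 1 N₁) ×ˢ (Finset.Ico 2 N₁)).filter
          (fun y => ((d * y.1 * y.2 : ℕ) : ℝ) < Skeleton.bigP D / Skeleton.bigT D ^ 2),
        term713 c' D a₁ (d, y.1, y.2) := by
    intro d _
    -- gate into the index set
    have e1 : ∀ k : ℕ,
        (if ((d * k : ℕ) : ℝ) < Skeleton.bigP D / Skeleton.bigT D ^ 2 then
          ∑ y ∈ k.divisorsAntidiagonal.filter (fun y => 1 < y.2),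
            term713 c' D a₁ (d, y.1, y.2) else 0) =
        ∑ y ∈ (k.divisorsAntidiagonal.filter (fun y => 1 < y.2)).filter
            (fun _ => ((d * k : ℕ) : ℝ) < Skeleton.bigP D / Skeleton.bigT D ^ 2),
          term713 c' D a₁ (d, y.1, y.2) := by
      intro k
      split_ifs with h
      · rw [Finset.filter_true_of_mem (fun _ _ => h)]
      · rw [Finset.filter_false_of_mem (fun _ _ => h), Finset.sum_empty]
    simp_rw [e1]
    rw [Finset.sum_sigma']
    set S := (Finset.Ico 1 N₁).sigma (fun k =>
      (k.divisorsAntidiagonal.filter (fun y => 1 < y.2)).filter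
        (fun _ => ((d * k : ℕ) : ℝ) < Skeleton.bigP D / Skeleton.bigT D ^ 2)) with hS
    -- membership facts on `S`
    have hSfacts : ∀ z ∈ S, z.2.1 * z.2.2 = z.1 ∧ 1 ≤ z.2.1 ∧ 1 < z.2.2 ∧
        z.2.1 < N₁ ∧ z.2.2 < N₁ ∧
        ((d * z.2.1 * z.2.2 : ℕ) : ℝ) < Skeleton.bigP D / Skeleton.bigT D ^ 2 := by
      intro z hz
      rw [hS, Finset.mem_sigma] at hz
      obtain ⟨hk, hy⟩ := hz
      rw [Finset.mem_Ico] at hk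
      obtain ⟨hy1, hcond⟩ := Finset.mem_filter.mp hy
      obtain ⟨hyd, hy2⟩ := Finset.mem_filter.mp hy1
      obtain ⟨hmul, hkne⟩ := Nat.mem_divisorsAntidiagonal.mp hyd
      have hh0 : 0 < z.2.1 := by
        rcases Nat.eq_zero_or_pos z.2.1 with h0 | h0
        · exfalso; rw [h0, zero_mul] at hmul; omega
        · exact h0
      have hr0 : 0 < z.2.2 := by omega
      have hh1 : z.2.1 ≤ z.1 := by
        calc z.2.1 ≤ z.2.1 * z.2.2 := Nat.le_mul_of_pos_right _ hr0
          _ = z.1 := hmul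
      have hr1 : z.2.2 ≤ z.1 := by
        calc z.2.2 ≤ z.2.1 * z.2.2 := Nat.le_mul_of_pos_left _ hh0
          _ = z.1 := hmul
      have hassoc : d * z.2.1 * z.2.2 = d * z.1 := by rw [Nat.mul_assoc, hmul]
      refine ⟨hmul, hh0, hy2, by omega, by omega, ?_⟩
      rw [hassoc]
      exact hcond
    -- the projection to the pair is injective on `S`
    have hinj : ∀ z₁ ∈ S, ∀ z₂ ∈ S, z₁.2 = z₂.2 → z₁ = z₂ := by
      intro z₁ hz₁ z₂ hz₂ h2
      obtain ⟨hm₁, -⟩ := hSfacts z₁ hz₁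
      obtain ⟨hm₂, -⟩ := hSfacts z₂ hz₂
      have h1 : z₁.1 = z₂.1 := by rw [← hm₁, ← hm₂, h2]
      exact Sigma.ext h1 (heq_of_eq h2)
    -- sum over the image, then over the (larger) filtered pair set
    have himg : ∑ z ∈ S, term713 c' D a₁ (d, z.2.1, z.2.2) =
        ∑ y ∈ S.image (fun z => z.2), term713 c' D a₁ (d, y.1, y.2) := by
      rw [Finset.sum_image hinj]
    have hsub : S.image (fun z => z.2) ⊆
        ((Finset.Ico 1 N₁) ×ˢ (Finset.Ico 2 N₁)).filter
          (fun y => ((d * y.1 * y.2 : ℕ) : ℝ) < Skeleton.bigP D / Skeleton.bigT D ^ 2) := by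
      intro y hy
      obtain ⟨z, hz, rfl⟩ := Finset.mem_image.mp hy
      obtain ⟨-, hh0, hr2, hhN, hrN, hcond⟩ := hSfacts z hz
      rw [Finset.mem_filter, Finset.mem_product, Finset.mem_Ico, Finset.mem_Ico]
      exact ⟨⟨⟨hh0, hhN⟩, hr2, hrN⟩, hcond⟩
    calc ∑ z ∈ S, term713 c' D a₁ (d, z.2.1, z.2.2)
        = ∑ y ∈ S.image (fun z => z.2), term713 c' D a₁ (d, y.1, y.2) := himg
      _ ≤ ∑ y ∈ ((Finset.Ico 1 N₁) ×ˢ (Finset.Ico 2 N₁)).filter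
            (fun y => ((d * y.1 * y.2 : ℕ) : ℝ) < Skeleton.bigP D / Skeleton.bigT D ^ 2),
            term713 c' D a₁ (d, y.1, y.2) :=
          Finset.sum_le_sum_of_subset_of_nonneg hsub fun y _ _ =>
            term713_nonnegE c' D a₁ (d, y.1, y.2)
  -- assemble the insertion
  have hfold : ∑ d ∈ Finset.Ico 1 N₁,
      ∑ y ∈ ((Finset.Ico 1 N₁) ×ˢ (Finset.Ico 2 N₁)).filter
        (fun y => ((d * y.1 * y.2 : ℕ) : ℝ) < Skeleton.bigP D / Skeleton.bigT D ^ 2),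
        term713 c' D a₁ (d, y.1, y.2) = ∑ x ∈ XT, term713 c' D a₁ x := by
    rw [hXT, Finset.sum_filter, Finset.sum_product]
    refine Finset.sum_congr rfl fun d _ => ?_
    rw [Finset.sum_filter]
  calc ‖∑ p ∈ Skeleton.primeWindow D, (p : ℂ) ^ Skeleton.beta3 c' D *
        Iface.frakT12 c' D p a₁ a₂‖
      = ‖∑ d ∈ Finset.Ico 1 N₁, 1 / (d : ℂ) *
          ∑ k ∈ Finset.Ico 1 N₁, a₂ (d * k) / ((k : ℂ) * (Nat.totient k : ℂ)) *
            innerSum712 c' D a₁ d k‖ := by rw [hid]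
    _ ≤ ∑ d ∈ Finset.Ico 1 N₁, ‖1 / (d : ℂ) *
          ∑ k ∈ Finset.Ico 1 N₁, a₂ (d * k) / ((k : ℂ) * (Nat.totient k : ℂ)) *
            innerSum712 c' D a₁ d k‖ := norm_sum_le _ _
    _ ≤ ∑ d ∈ Finset.Ico 1 N₁, ∑ k ∈ Finset.Ico 1 N₁,
          ‖1 / (d : ℂ) * (a₂ (d * k) / ((k : ℂ) * (Nat.totient k : ℂ)) *
            innerSum712 c' D a₁ d k)‖ := by
        refine Finset.sum_le_sum fun d _ => ?_
        rw [Finset.mul_sum]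
        exact norm_sum_le _ _
    _ ≤ ∑ d ∈ Finset.Ico 1 N₁, ∑ k ∈ Finset.Ico 1 N₁,
          B₀ * C₀' * (if ((d * k : ℕ) : ℝ) < Skeleton.bigP D / Skeleton.bigT D ^ 2 then
            ∑ y ∈ k.divisorsAntidiagonal.filter (fun y => 1 < y.2),
              term713 c' D a₁ (d, y.1, y.2) else 0) :=
        Finset.sum_le_sum fun d hd => Finset.sum_le_sum fun k hk => hdk d hd k hk
    _ = B₀ * C₀' * ∑ d ∈ Finset.Ico 1 N₁, ∑ k ∈ Finset.Ico 1 N₁,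
          (if ((d * k : ℕ) : ℝ) < Skeleton.bigP D / Skeleton.bigT D ^ 2 then
            ∑ y ∈ k.divisorsAntidiagonal.filter (fun y => 1 < y.2),
              term713 c' D a₁ (d, y.1, y.2) else 0) := by
        simp_rw [← Finset.mul_sum]
    _ ≤ B₀ * C₀' * ∑ d ∈ Finset.Ico 1 N₁,
          ∑ y ∈ ((Finset.Ico 1 N₁) ×ˢ (Finset.Ico 2 N₁)).filter
            (fun y => ((d * y.1 * y.2 : ℕ) : ℝ) < Skeleton.bigP D / Skeleton.bigT D ^ 2),
            term713 c' D a₁ (d, y.1, y.2) := by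
        refine mul_le_mul_of_nonneg_left ?_ (by positivity)
        exact Finset.sum_le_sum htri
    _ = B₀ * C₀' * ∑ x ∈ XT, term713 c' D a₁ x := by rw [hfold]

/-! ## (7.11) holds -/

/-- **`Z22:(7.11)` HOLDS** (`Iface.Eq711 c′`, the literal reading of slice L2-t3): for every `B`
and `ε > 0`, for all large `D` under (A) and all admissible `𝐚₁, 𝐚₂`,
`‖Σ_{p∼P} p^{β₃}𝔗₁₂(p)‖ ≤ ε𝔓` — the honest insertion `insertX` (over the FULL (7.2) support, no
`dhr < P₁` restriction), the extended-range triple-sum bound `sum_tripleX_le`, and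
`𝔓 ≥ ½P²𝓛⁻⁷⁷` ((2.9), `frakP_bounds`).
[cite: Zhang2022LandauSiegel, §7 (7.11) p.37, tex L1980] -/
theorem eq711X_holds (c' : ℝ) : Iface.Eq711 c' := by
  intro B ε hε
  obtain ⟨CI, hCI0, DI, hI⟩ := insertX c' B
  obtain ⟨c, hc, DT, hT⟩ := sum_tripleX_le c' B
  obtain ⟨DP, hDP⟩ := frakP_bounds
  obtain ⟨DE, hDE⟩ := ell_pow_mul_rpow_neg_eventuallyE 77 hc hε (4 * CI)
  obtain ⟨Dell, hell⟩ := Skeleton.exists_nat_forall_le_ell 2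
  refine ⟨DI + DT + DP + DE + Dell + 3, fun D _ χ hD hq hp hA a₁ a₂ ha₁ ha₂ => ?_⟩
  have hDI : DI ≤ D := by omega
  have hDT : DT ≤ D := by omega
  have hDP' : DP ≤ D := by omega
  have hDE' : DE ≤ D := by omega
  have hDell : Dell ≤ D := by omega
  have hD3 : 3 ≤ D := by omega
  have hℓ2 : 2 ≤ Skeleton.ell D := hell D hDell
  have hDpos : (0 : ℝ) < D := by exact_mod_cast (show 0 < D by omega)
  -- the two main bounds at this `D`
  have h1 := hI D χ hDI hq hp hA a₁ a₂ ha₁ ha₂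
  have h2 := hT D χ hDT hq hp hA a₁ ha₁
  -- `𝔓 ≥ ½P²𝓛⁻⁷⁷`
  have hfrakP : bigP D ^ 2 * (Skeleton.ell D ^ 77)⁻¹ / 2 ≤ frakP D := by
    have hP := hDP D hDP'
    change |frakP D - bigP D ^ 2 * (Skeleton.ell D ^ 77)⁻¹| ≤
      3 * (Skeleton.ell D ^ 68)⁻¹ * (bigP D ^ 2 * (Skeleton.ell D ^ 77)⁻¹) at hP
    have hℓ68 : (2 ^ 68 : ℝ) ≤ Skeleton.ell D ^ 68 := pow_le_pow_left₀ (by norm_num) hℓ2 68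
    have h3 : 3 * (Skeleton.ell D ^ 68)⁻¹ ≤ 1 / 2 := by
      rw [show 3 * (Skeleton.ell D ^ 68)⁻¹ = 3 / Skeleton.ell D ^ 68 by ring,
        div_le_iff₀ (by positivity)]
      nlinarith
    have hX : 0 ≤ bigP D ^ 2 * (Skeleton.ell D ^ 77)⁻¹ := by positivity
    have h4 : 3 * (Skeleton.ell D ^ 68)⁻¹ * (bigP D ^ 2 * (Skeleton.ell D ^ 77)⁻¹) ≤
        1 / 2 * (bigP D ^ 2 * (Skeleton.ell D ^ 77)⁻¹) := mul_le_mul_of_nonneg_right h3 hX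
    have h5 := (abs_le.mp hP).1
    linarith
  -- the decay of the coefficient
  have hEc := hDE D hDE'
  set X : ℝ := bigP D ^ 2 * (Skeleton.ell D ^ 77)⁻¹ / 2 with hXdef
  have hX0 : 0 ≤ X := by positivity
  have hP2 : bigP D ^ 2 = 2 * X * Skeleton.ell D ^ 77 := by
    have h77 : Skeleton.ell D ^ 77 ≠ 0 := by positivity
    calc bigP D ^ 2 = bigP D ^ 2 * ((Skeleton.ell D ^ 77)⁻¹ * Skeleton.ell D ^ 77) := by
          rw [inv_mul_cancel₀ h77, mul_one]
      _ = 2 * X * Skeleton.ell D ^ 77 := by rw [hXdef]; ring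
  calc ‖∑ p ∈ Skeleton.primeWindow D, (p : ℂ) ^ Skeleton.beta3 c' D *
        Iface.frakT12 c' D p a₁ a₂‖
      ≤ CI * ∑ x ∈ ((Finset.Ico 1 (Skeleton.Nsupp D)) ×ˢ ((Finset.Ico 1 (Skeleton.Nsupp D)) ×ˢ
            (Finset.Ico 2 (Skeleton.Nsupp D)))).filter
          (fun x => ((x.1 * x.2.1 * x.2.2 : ℕ) : ℝ) <
            Skeleton.bigP D / Skeleton.bigT D ^ 2),
          term713 c' D a₁ x := h1
    _ ≤ CI * (2 * Skeleton.bigP D ^ 2 * (D : ℝ) ^ (-c)) := by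
        exact mul_le_mul_of_nonneg_left h2 hCI0
    _ = X * (4 * CI * Skeleton.ell D ^ 77 * (D : ℝ) ^ (-c)) := by
        rw [hP2]; ring
    _ ≤ X * ε := mul_le_mul_of_nonneg_left hEc hX0
    _ ≤ frakP D * ε := mul_le_mul_of_nonneg_right hfrakP (le_of_lt hε)
    _ = ε * frakP D := mul_comm _ _

/-- `Eq711` holds for all parameters — `_holds` alias of `eq711X_holds` above under the fact's exact name
(appended 2026-08-28, D-0026 bookkeeping: the proof term is the existing theorem of this file; no statement,
definition or attribute is edited; no new named fact; the ledger's debt table listed the fact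
unproved). [cite: Zhang2022LandauSiegel, §7 (7.11) p.37, tex L1980] -/
theorem _root_.Literature.NumberTheory.LFunctions.Zhang2022.Section7cStatements.Iface.Eq711_holds
    (c' : ℝ) :
    Iface.Eq711 c' :=
  _root_.Literature.NumberTheory.LFunctions.Zhang2022.Section7cStatements.eq711X_holds c'

/-- **`Z22:(7.11)` HOLDS**, owner's statement (`Section7bStatements.Eq711 c′`).
[cite: Zhang2022LandauSiegel, §7 (7.11) p.37, tex L1980] -/
theorem eq711X'_holds (c' : ℝ) : Section7bStatements.Eq711 c' :=
  (Iface.eq711_iff c').mp (eq711X_holds c')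

/-- `Section7bStatements.Eq711` holds for all parameters — `_holds` alias of `eq711X'_holds` above
(appended 2026-08-28, D-0026 bookkeeping: the proof term is the existing theorem of this file;
no statement, definition or attribute is edited; no new named fact).
[cite: Zhang2022LandauSiegel, §7 (7.11) p.37, tex L1980] -/
theorem _root_.Literature.NumberTheory.LFunctions.Zhang2022.Section7bStatements.Eq711_holds (c' : ℝ) :
    Section7bStatements.Eq711 c' :=
  eq711X'_holds c'

end Literature.NumberTheory.LFunctions.Zhang2022.Section7cStatements
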